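import Summits.QuantumAdvantage.QuantumAdvantage.Theorems.CubicForrelationNearExactIsExactIsolationSmallN

/-!
# Crux `CubicForrelation.NearExactIsExact` (stmt-QuantumAdvantage-14043) — the tower WALK: the open core starts at `n = 30`

Line `direct-sum-amplification`, lead c6 (§4f). The 2-adic Walsh tower (`stub_walshTower`, `stub_levelCapacity`,
`stub_levelBent`, assembled in `…IsolationSmallN.lean`) walked GENERICALLY. The tower degree has the closed form
`d(n,j) = ⌊(3j − n)/2⌋` (a `k` is admissible at level `j` iff `k + ⌈(n−k)/3⌉ = ⌈(2k+n)/3⌉ ≤ j` iff `2k + n ≤ 3j`), so the side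
condition of `stub_walshTower` is pure linear arithmetic, and the cost of level `j < m` is `2^{−(d+1)}·4^{−(m−j)}` with exponent
`d(n,j) + 1 + 2(m−j) ≈ m + 1 − j/2`, largest at the Ax base `j₀ = ⌈2m/3⌉`, where it is `≈ 2m/3 + 1`.

* `tower_walk`: for cubic `g` on `m + m` bits, a degree table `dj` satisfying the side condition at every level `j₀ ≤ j ≤ m`,
  and level-cost EXPONENTS `dj j + 1 + 2(m−j) ≤ C` (`j < m`), `dj m + 1 ≤ C`: `g` is bent or `Σ_x |W_g(x)| ≤ 2^{3m}(1 − 2^{−C})`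
  (induction up the levels: `tw_base`, `tw_step`, `tw_top`).
* `nonBent_capacity_le_28`: **every NON-bent cubic `g` on `m + m` bits with `5 ≤ m ≤ 14` has `Σ_x |W_g(x)| ≤ 2^{3m}(1 − 2⁻¹⁰)`**
  (all hypotheses of the walk discharged by `omega` with `dj j = (3j − 2m)/2`, `C = 10`), hence `nonBentBand_le_28`:
  **`Φ(f,g) ≤ 1 − 2⁻¹⁰` for EVERY `f`** — the non-bent branch of the line's core (`stub_nonBentBand`, window bottom `1 − 2⁻¹⁰`)
  is EMPTY for `10 ≤ n ≤ 28`; it starts at `n = 30`, where the type-O base level costs only `2⁻¹¹` (the bent branch starts at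
  `n = 42` by Hou).
* `capacity_ten`: every non-bent cubic on 10 bits has capacity `≤ 15/16` — TIGHT (`g = A(ȳ) ⊕ y₉(B(ȳ) ⊕ y₁₀)` with `A` cubic bent
  on 8 bits and `A ⊕ B` of capacity `7/8` has capacity exactly `15/16`).
* `isolation_window_le_28`: **for `3 ≤ m ≤ 14` and all cubic `f, g` on `m + m` bits, `Φ(f,g) > 1 − 2⁻¹⁰ ⇒ Φ(f,g) = 1`** (bent `g`:
  Hou + Reed–Muller; non-bent: the walk) — the line's window `(1 − 2⁻¹⁰, θ₂)` is EMPTY for every `n ≤ 28`, so the whole open core of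
  the crux (both branches) lives at `n ≥ 30`; with the `n ≤ 6` certificate this makes `NearExactIsExact` equivalent to its
  restriction to `n ≥ 30` (companion computational file).

Sources: as in `…IsolationSmallN.lean` (Ax 1964 / McEliece 1972, Rothaus 1976, Hou 1998, Carlet 2021, Aaronson–Ambainis 2018).
Everything below is proved from Mathlib and the tree; axioms are the standard three; no `decide`, no definitions.
-/

set_option linter.dupNamespace false -- D-0017: single-problem summit ⇒ `QuantumAdvantage.QuantumAdvantage` by design

noncomputable section

namespace Summit.QuantumAdvantage.QuantumAdvantage.Theorems.CubicForrelation.NearExactIsExact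

open Finset
open Literature.Computability.QuantumComplexity
open Literature.Computability.QuantumComplexity.DerivativeWalsh (W)

/-! ### The generic walk -/

/-- From the level-cost exponent `d + 1 + 2t ≤ C` to the real inequality `(1/2)^C ≤ (1/2)^{d+1}·(1/4)^{t}`. [folklore] -/
theorem tw_cost_le {d t C : ℕ} (h : d + 1 + 2 * t ≤ C) :
    (1 / 2 : ℝ) ^ C ≤ (1 / 2) ^ (d + 1) * (1 / 4) ^ t := by
  have e : (1 / 2 : ℝ) ^ (d + 1) * (1 / 4) ^ t = (1 / 2) ^ (d + 1 + 2 * t) := by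
    conv_rhs => rw [pow_add, pow_mul]
    norm_num
  rw [e]
  exact pow_le_pow_of_le_one (by norm_num) (by norm_num) h

/-- **The tower walk.** For cubic `g` on `m + m` bits: given a degree table `dj` satisfying the tower side condition at every
level `j₀ ≤ j ≤ m` (`j₀ = (2m+2)/3 = ⌈2m/3⌉`, the Ax base), level-cost exponents `dj j + 1 + 2(m−j) ≤ C` for `j₀ ≤ j < m` and
`dj m + 1 ≤ C` at the bent level, either `g` is bent or `Σ_x |W_g(x)| ≤ 2^{3m}(1 − 2^{−C})`.  Proof: induction up the levels from
the Ax base (`tw_base`): at `j < m`, `tw_step` either caps the capacity by the level cost or lifts the divisibility to `j + 1`; at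
`j = m`, `tw_top`. -/
theorem tower_walk (m j₀ C : ℕ) (dj : ℕ → ℕ) (g : (Fin (m + m) → Bool) → Bool) (hg : IsDegLeFun 3 g) (hj₀m : j₀ ≤ m)
    (hbase : (m + m + 2) / 3 = j₀)
    (hside : ∀ j, j₀ ≤ j → j ≤ m → ∀ k, dj j < k → k ≤ m + m → j + 1 ≤ k + (m + m - k + 2) / 3)
    (hcost : ∀ j, j₀ ≤ j → j < m → dj j + 1 + 2 * (m - j) ≤ C)
    (htop : dj m + 1 ≤ C) :
    (∀ x, W (fun y => signOf (g y)) x ^ 2 = (2 : ℝ) ^ (m + m)) ∨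
      ∑ x, |W (fun y => signOf (g y)) x| ≤ (2 : ℝ) ^ (3 * m) * (1 - (1 / 2) ^ C) := by
  -- the invariant, by induction on the number `t` of levels still to climb from level `j = m - t`
  have key : ∀ t j, j + t = m → j₀ ≤ j → ∀ u : (Fin (m + m) → Bool) → ℤ,
      (∀ x, W (fun y => signOf (g y)) x = (2 : ℝ) ^ j * (u x : ℝ)) →
      (∀ x, W (fun y => signOf (g y)) x ^ 2 = (2 : ℝ) ^ (m + m)) ∨
        ∑ x, |W (fun y => signOf (g y)) x| ≤ (2 : ℝ) ^ (3 * m) * (1 - (1 / 2) ^ C) := by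
    intro t
    induction t with
    | zero =>
      intro j hjm hj₀ u hu
      rw [add_zero] at hjm
      subst hjm
      rcases tw_top (d := dj j) g u hg hu (hside j hj₀ le_rfl) with hbent | hcap
      · exact Or.inl hbent
      · right
        refine hcap.trans (mul_le_mul_of_nonneg_left ?_ (by positivity))
        have := tw_cost_le (t := 0) (by simpa using htop)
        simp only [pow_zero, mul_one] at this
        linarith
    | succ t ih =>
      intro j hjm hj₀ u hu
      have hjlt : j < m := by omega
      rcases tw_step (d := dj j) g u hg hjlt hu (hside j hj₀ hjlt.le) with hcap | ⟨u', hu'⟩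
      · right
        refine hcap.trans (mul_le_mul_of_nonneg_left ?_ (by positivity))
        have := tw_cost_le (hcost j hj₀ hjlt)
        linarith
      · exact ih (j + 1) (by omega) (by omega) u' hu'
  obtain ⟨u₀, hu₀⟩ := tw_base g hg j₀ hbase
  exact key (m - j₀) j₀ (by omega) le_rfl u₀ hu₀

/-- **The walk with the closed-form degree table `d(2m,j) = (3j − 2m)/2`** (the side condition is then linear arithmetic): for
cubic `g` on `m + m` bits, `2 ≤ m`, if `(3j − 2m)/2 + 1 + 2(m − j) ≤ C` for every `⌈2m/3⌉ ≤ j < m` and `m/2 + 1 ≤ C`, then `g` is bent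
or `Σ_x |W_g(x)| ≤ 2^{3m}(1 − 2^{−C})`. -/
theorem tower_walk_closed (m C : ℕ) (g : (Fin (m + m) → Bool) → Bool) (hg : IsDegLeFun 3 g) (hm : 2 ≤ m)
    (hcost : ∀ j, (m + m + 2) / 3 ≤ j → j < m → (3 * j - (m + m)) / 2 + 1 + 2 * (m - j) ≤ C)
    (htop : (3 * m - (m + m)) / 2 + 1 ≤ C) :
    (∀ x, W (fun y => signOf (g y)) x ^ 2 = (2 : ℝ) ^ (m + m)) ∨
      ∑ x, |W (fun y => signOf (g y)) x| ≤ (2 : ℝ) ^ (3 * m) * (1 - (1 / 2) ^ C) :=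
  tower_walk m ((m + m + 2) / 3) C (fun j => (3 * j - (m + m)) / 2) g hg (by omega) rfl
    (by intro j _ _ k hk hkn; omega) hcost htop

/-! ### Instances: the non-bent core is empty in the window for `10 ≤ n ≤ 28`; capacity `15/16` at `n = 10` -/

/-- **Non-bent cubics on `10 ≤ n ≤ 28` bits have Walsh capacity at most `2^{3m}(1 − 2⁻¹⁰)`.** For `5 ≤ m ≤ 14` and cubic `g` on
`m + m` bits that is not bent, `Σ_x |W_g(x)| ≤ 2^{3m}(1 − 2⁻¹⁰)`: every 2-adic level of the tower costs at least `2⁻¹⁰` in this range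
(cost exponent `(3j − 2m)/2 + 1 + 2(m−j) ≤ 10`, by `omega`; the first level cheaper than `2⁻¹⁰` is the type-O base level at
`n = 30`, cost `2⁻¹¹`). -/
theorem nonBent_capacity_le_28 :
    ∀ (m : ℕ), 5 ≤ m → m ≤ 14 → ∀ g : (Fin (m + m) → Bool) → Bool, IsDegLeFun 3 g →
      ¬ (∀ x, W (fun y => signOf (g y)) x ^ 2 = (2 : ℝ) ^ (m + m)) →
      ∑ x, |W (fun y => signOf (g y)) x| ≤ (2 : ℝ) ^ (3 * m) * (1 - (1 / 2) ^ 10) := by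
  intro m h5 h14 g hg hnb
  rcases tower_walk_closed m 10 g hg (by omega) (by intro j hj₀ hjm; omega) (by omega) with h | h
  · exact absurd h hnb
  · exact h

/-- **The non-bent band of the line's core holds for `10 ≤ n ≤ 28`, unconditionally and for EVERY partner `f`:** for
`5 ≤ m ≤ 14`, cubic `g` on `m + m` bits not bent, and any Boolean `f`, `Φ(f,g) ≤ 1 − 2⁻¹⁰`. So `stub_nonBentBand` (window
bottom `1 − 2⁻¹⁰`) is vacuous below `n = 30`: the non-bent core STARTS AT `n = 30`. -/
theorem nonBentBand_le_28 :
    ∀ (m : ℕ), 5 ≤ m → m ≤ 14 → ∀ f g : (Fin (m + m) → Bool) → Bool, IsDegLeFun 3 g →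
      ¬ (∀ x, W (fun y => signOf (g y)) x ^ 2 = (2 : ℝ) ^ (m + m)) →
      forrelation f g ≤ 1 - 1 / 1024 := by
  intro m h5 h14 f g hg hnb
  have h := tw_forrelation_le_of_cap f g (nonBent_capacity_le_28 m h5 h14 g hg hnb)
  norm_num at h ⊢
  exact h

/-- **Non-bent cubics on 10 bits have Walsh capacity at most `15/16`** (TIGHT): for cubic `g : 𝔽₂¹⁰ → 𝔽₂` not bent,
`Σ_x |W_g(x)| ≤ 2¹⁵·(15/16) = 30720` (level 4: affine parity, cost `1/16`; level 5: bent or cost `1/8`). -/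
theorem capacity_ten :
    ∀ g : (Fin (5 + 5) → Bool) → Bool, IsDegLeFun 3 g →
      ¬ (∀ x, W (fun y => signOf (g y)) x ^ 2 = (2 : ℝ) ^ (5 + 5)) →
      ∑ x, |W (fun y => signOf (g y)) x| ≤ 30720 := by
  intro g hg hnb
  rcases tower_walk_closed 5 4 g hg (by norm_num) (by intro j hj₀ hjm; omega) (by norm_num) with h | h
  · exact absurd h hnb
  · norm_num at h; exact h


/-! ### The window is empty below `n = 30`: `1 − 2⁻¹⁰` isolates exactness for `6 ≤ n ≤ 28` -/

/-- **`1 − 2⁻¹⁰` isolates exactness for every `6 ≤ n ≤ 28`, unconditionally.** For `3 ≤ m ≤ 14` and all cubic `f, g` on `m + m`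
bits, `Φ(f,g) > 1 − 2⁻¹⁰ ⇒ Φ(f,g) = 1`.  Bent `g`: the dual has degree `≤ ⌊(m+3)/2⌋ ≤ 8` (Hou), so `Φ = 1 ∨ Φ ≤ 1 − 2⁻⁷`
(`tw_bent_end`); non-bent `g`: the walk (`Φ ≤ 1 − 2⁻¹⁰`).  So the line's window `(1 − 2⁻¹⁰, θ₂)` is EMPTY for every `n ≤ 28`
(`n ≤ 4` by value granularity / the `n ≤ 6` certificate): BOTH branches of the open core start at `n ≥ 30` (non-bent) and
`n ≥ 42` (bent). -/
theorem isolation_window_le_28 :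
    ∀ (m : ℕ), 3 ≤ m → m ≤ 14 → ∀ f g : (Fin (m + m) → Bool) → Bool, IsDegLeFun 3 f → IsDegLeFun 3 g →
      1 - 1 / 1024 < forrelation f g → forrelation f g = 1 := by
  intro m h3 h14 f g hf hg hΦ
  by_cases hbent : ∀ x, W (fun y => signOf (g y)) x ^ 2 = (2 : ℝ) ^ (m + m)
  · rcases tw_bent_end h3 f g hf hg hbent with h | h
    · exact h
    · exfalso
      have h8 : (m + 3) / 2 ≤ 8 := by omega
      have hle : (2 : ℝ) / 2 ^ 8 ≤ 2 / 2 ^ ((m + 3) / 2) :=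
        div_le_div_of_nonneg_left (by norm_num) (by positivity) (pow_le_pow_right₀ (by norm_num) h8)
      norm_num at hle hΦ h
      linarith
  · rcases tower_walk_closed m 10 g hg (by omega) (by intro j hj₀ hjm; omega) (by omega) with h | h
    · exact absurd h hbent
    · have := tw_forrelation_le_of_cap f g h
      norm_num at this hΦ
      linarith

end Summit.QuantumAdvantage.QuantumAdvantage.Theorems.CubicForrelation.NearExactIsExact

end
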